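import Summits.AtomisticToContinuum.Crystallization.Theorems.FreeSplittingCertificatesStrictSplittingRuleCoreDefsStar
import Summits.AtomisticToContinuum.Crystallization.Theorems.FreeSplittingCertificatesStrictSplittingRuleCoreFirstOrderDesignGeometry

/-!
# Summability of the naive half-split second variation over the hcp lattice

Helper of reshape r5 (lead c5) of crux `StrictSplittingRule` (stmt-AtomisticToContinuum-12560), line `registered`:
toward the glue `H2N ∧ H2F ⇒ CoreStarCoercive` (near-field LMI + far-field Korn export ⇒ H2⋆). Registered stub, landed
`--supports stmt-AtomisticToContinuum-12560`.
-/

noncomputable section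

namespace Summit.AtomisticToContinuum.Crystallization.Theorems.StrictSplittingRuleBirth

open scoped BigOperators Classical
open Literature.MathematicalPhysics.StatisticalMechanics
open Literature.Geometry.DiscreteGeometry
open Summit.AtomisticToContinuum.Crystallization.Theorems.PalmUnimodularRigidity.LayeredLawsSelectHcp
  (hcpSite ljSqDeriv)

/-- Euclidean `3`-space. -/
local notation "E3" => EuclideanSpace ℝ (Fin 3)

/-- Off the site `p` the relative site vector does not vanish: `0 < ‖y_q − y_p‖` for `q ≠ p` (`a, h > 0`; the site
map is injective, `hcp_injective`). [folklore] -/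
theorem summableBare_norm_sub_pos {a h : ℝ} (ha : 0 < a) (hh : 0 < h) {p q : ℤ × ℤ × ℤ} (hq : q ≠ p) :
    0 < ‖hcpSite a h q - hcpSite a h p‖ := by
  rw [norm_pos_iff, sub_ne_zero]
  exact fun e => hq (EnergyDerivativeOrderDanskin.hcp_injective ha.ne' hh.ne' e)

/-- **Inverse powers `n > 3` of the relative site norms `‖y_q − y_p‖` are summable over `q ∈ ℤ³`** (the root sum
`h1_summable_inv_pow` re-based at `p` by the covariance `y_{p+d} − y_p = y_d` / `−y_{−d}` of the two layer parities,
`h1_sub_of_even` / `h1_sub_of_odd`). [folklore] -/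
theorem summableBare_inv_pow_sub {a h : ℝ} (ha : 0 < a) (hh : 0 < h) (p : ℤ × ℤ × ℤ) {n : ℕ} (hn : 3 < n) :
    Summable fun q : ℤ × ℤ × ℤ => if q = p then (0 : ℝ) else (‖hcpSite a h q - hcpSite a h p‖⁻¹) ^ n := by
  have hs := h1_summable_inv_pow ha.ne' hh.ne' hn
  rcases Int.even_or_odd p.1 with hp | hp
  · refine (hs.comp_injective (sub_left_injective (b := p))).congr fun q => ?_
    have e := h1_sub_of_even a h hp (q - p)
    rw [add_sub_cancel] at e
    show (if q - p = 0 then (0 : ℝ) else (‖hcpSite a h (q - p)‖⁻¹) ^ n) = _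
    by_cases hq : q = p
    · simp [hq]
    · rw [if_neg (sub_ne_zero.2 hq), if_neg hq, e]
  · refine (hs.comp_injective (sub_right_injective (b := p))).congr fun q => ?_
    have e := h1_sub_of_odd a h hp (q - p)
    rw [add_sub_cancel, neg_sub] at e
    show (if p - q = 0 then (0 : ℝ) else (‖hcpSite a h (p - q)‖⁻¹) ^ n) = _
    by_cases hq : q = p
    · simp [hq]
    · rw [if_neg (sub_ne_zero.2 (Ne.symm hq)), if_neg hq, e, norm_neg]

/-- **The far tail term at one site is `O(‖D‖⁻⁸)`**: for `D ≠ 0` and any `w` in `ℝ³`,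
`|½(W′(‖D‖²)‖w‖² + 2W″(‖D‖²)⟨D, w⟩²)| ≤ ‖w‖²·(9/4·‖D‖⁻⁸ + 15/4·‖D‖⁻¹⁴)`, from `|W′(s)| ≤ ½(s⁻⁴ + s⁻⁷)`,
`|W″(s)| ≤ ½(7s⁻⁸ + 4s⁻⁵)` and Cauchy–Schwarz `⟨D, w⟩² ≤ ‖D‖²‖w‖²`. [folklore] -/
theorem summableBare_tail_abs_le (D w : EuclideanSpace ℝ (Fin 3)) (hD : 0 < ‖D‖) :
    |1 / 2 * (ljSqDeriv (‖D‖ ^ 2) * ‖w‖ ^ 2 +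
        2 * (1 / 2 * (7 * ((‖D‖ ^ 2)⁻¹) ^ 8 - 4 * ((‖D‖ ^ 2)⁻¹) ^ 5)) * (inner ℝ D w) ^ 2)| ≤
      ‖w‖ ^ 2 * (9 / 4) * (‖D‖⁻¹) ^ 8 + ‖w‖ ^ 2 * (15 / 4) * (‖D‖⁻¹) ^ 14 := by
  have hle : (inner ℝ D w) ^ 2 ≤ ‖D‖ ^ 2 * ‖w‖ ^ 2 := by
    rw [← mul_pow, ← sq_abs]
    exact pow_le_pow_left₀ (abs_nonneg _) (abs_real_inner_le_norm D w) 2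
  have h2 : (‖D‖ ^ 2)⁻¹ = ‖D‖⁻¹ ^ 2 := by rw [inv_pow]
  unfold ljSqDeriv
  rw [h2]
  set x := ‖D‖⁻¹ with hx
  set N := ‖w‖ ^ 2 with hN
  set I := (inner ℝ D w) ^ 2 with hI
  have hx0 : 0 ≤ x := inv_nonneg.2 hD.le
  have hN0 : 0 ≤ N := sq_nonneg _
  have hI0 : 0 ≤ I := sq_nonneg _
  have h1 : x ^ 2 * I ≤ N := by
    have hxD : x ^ 2 * ‖D‖ ^ 2 = 1 := by rw [hx, ← mul_pow, inv_mul_cancel₀ hD.ne', one_pow]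
    calc x ^ 2 * I ≤ x ^ 2 * (‖D‖ ^ 2 * N) := mul_le_mul_of_nonneg_left hle (pow_nonneg hx0 2)
      _ = N := by rw [← mul_assoc, hxD, one_mul]
  have k1 := mul_nonneg (pow_nonneg hx0 14) (sub_nonneg.2 h1)
  have k2 := mul_nonneg (pow_nonneg hx0 8) (sub_nonneg.2 h1)
  have k3 := mul_nonneg (pow_nonneg hx0 8) hN0
  have k4 := mul_nonneg (pow_nonneg hx0 14) hN0
  have k5 := mul_nonneg (pow_nonneg hx0 16) hI0
  have k6 := mul_nonneg (pow_nonneg hx0 10) hI0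
  rw [abs_le]
  constructor
  · nlinarith [k1, k2, k3, k4, k5, k6]
  · nlinarith [k1, k2, k3, k4, k5, k6]

/-- **stub_summableBareSecondVariation** (r5 helper, glue): for a finitely supported displacement field `u` and any
site `p`, the family of naive half-split pair second variations `q ↦ ½(W′‖u_q−u_p‖² + 2W″⟨y_q−y_p,u_q−u_p⟩²)` (the first
series on the right of `CoreStarCoercive`) is summable over `ℤ³` (cofinitely it is `O(‖y_q − y_p‖⁻⁸)·‖u_p‖²`;
`h1_summable_inv_pow`, `h1_sub_eq`). [folklore] -/
theorem stub_summableBareSecondVariation : ∀ a h : ℝ, 0 < a → 0 < h →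
    ∀ u : ℤ × ℤ × ℤ → E3, (Function.support u).Finite → ∀ p : ℤ × ℤ × ℤ,
      Summable fun q : ℤ × ℤ × ℤ => (if q = p then (0 : ℝ) else
          1 / 2 * (ljSqDeriv (‖hcpSite a h q - hcpSite a h p‖ ^ 2) * ‖u q - u p‖ ^ 2 +
            2 * (1 / 2 * (7 * ((‖hcpSite a h q - hcpSite a h p‖ ^ 2)⁻¹) ^ 8 -
              4 * ((‖hcpSite a h q - hcpSite a h p‖ ^ 2)⁻¹) ^ 5)) *
              (inner ℝ (hcpSite a h q - hcpSite a h p) (u q - u p)) ^ 2)) := by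
  intro a h ha hh u hu p
  -- the tail family: `u q` replaced by `0`; dominated by `‖u p‖²(9/4‖D‖⁻⁸ + 15/4‖D‖⁻¹⁴)`
  have hT : Summable fun q : ℤ × ℤ × ℤ => (if q = p then (0 : ℝ) else
      1 / 2 * (ljSqDeriv (‖hcpSite a h q - hcpSite a h p‖ ^ 2) * ‖u p‖ ^ 2 +
        2 * (1 / 2 * (7 * ((‖hcpSite a h q - hcpSite a h p‖ ^ 2)⁻¹) ^ 8 -
          4 * ((‖hcpSite a h q - hcpSite a h p‖ ^ 2)⁻¹) ^ 5)) *
          (inner ℝ (hcpSite a h q - hcpSite a h p) (u p)) ^ 2)) := by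
    have h8 := summableBare_inv_pow_sub ha hh p (show 3 < 8 by norm_num)
    have h14 := summableBare_inv_pow_sub ha hh p (show 3 < 14 by norm_num)
    refine Summable.of_norm_bounded
      ((h8.mul_left (‖u p‖ ^ 2 * (9 / 4))).add (h14.mul_left (‖u p‖ ^ 2 * (15 / 4)))) fun q => ?_
    rw [Real.norm_eq_abs]
    by_cases hq : q = p
    · simp [hq]
    · simp only [if_neg hq]
      exact summableBare_tail_abs_le _ _ (summableBare_norm_sub_pos ha hh hq)
  -- the full family agrees with the tail family off the finite support of `u`
  refine hT.congr_cofinite (Filter.eventually_cofinite.2 (hu.subset fun q hq => ?_))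
  by_contra h0
  rw [Function.mem_support, not_not] at h0
  refine absurd ?_ hq
  simp only [h0, zero_sub, norm_neg, inner_neg_right, neg_sq]

end Summit.AtomisticToContinuum.Crystallization.Theorems.StrictSplittingRuleBirth

end
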